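import Summits.AtomisticToContinuum.Crystallization.Theorems.FrustratedLawDichotomyStrainedPatchHomEntryFitSharp

/-!
# The sharp (P1) fit prune in CARTESIAN label coordinates: `⟪Vq,q⟫` and `‖Vq‖²` evaluated directly from the nine deviation entries

decomp-a2c hand-2 g22 (crux `AperiodicFrustratedLawGap`, stmt-AtomisticToContinuum-27623; sequel of `…HomEntryFitSharp`).  MEASURED: `fitOK2`'s radial term
`⟪Vq,q⟫ − min ⟪Vq',q'⟫` is evaluated through the frame expansion (`hgramFI`, sixteen entry intervals per label) and carries ≈ 4× the intrinsic box width
(`±0.008` vs `±0.002` at half-width `2⁻¹⁰`), so it fails at uniaxial strain `e = 0.05` (ratio 1.16) although the true fit reaches `e ≈ 0.069`.  Here the two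
quadratic data are computed in CARTESIAN coordinates of the kissing vector `q = (√2)⁻¹ • intVec p`, `p = recon b ∈ ℤ³`: `W_a = Σ_b p_b v_ab` (two entry
intervals), `⟪Vq,q⟫ = ½ Σ_a p_a W_a`, `‖Vq‖² = ½ Σ_a W_a²` — widths at the intrinsic scale.  Everything else is `…HomEntryFitSharp` verbatim:
`pMinC`, `tangHiC`, `kissSqC`, `dSqC`, `dEnclC`, ★ `fitOK3`, ★★ `fitOK3_sound` (via `goodAtScale_of_fitBounds_min`), `entryLeafOKF3 μ := fitOK3 ∨ entryLeafOKF2 μ`,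
★★★ `fccHalf_of_entryFit3Tree`; kernel smoke test (§4).
All definitions computable; 0 sorry; standard axioms; no instances / notation.  `--supports stmt-AtomisticToContinuum-27623`.
-/

namespace Summit.AtomisticToContinuum.Crystallization.Theorems.FrustratedLawDichotomyStrainedPatchHomEntryFitCart

open scoped BigOperators RealInnerProductSpace
open Literature.Analysis.ValidatedNumerics.Numerics
open Literature.Geometry.DiscreteGeometry (fccKissingPattern fccInt card_fccKissingPattern norm_eq_one_of_mem_fccKissingPattern)
open Summit.AtomisticToContinuum.Crystallization.Theorems.ChargedEnergyGapNegative (E3)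
open Summit.AtomisticToContinuum.Crystallization.Theorems.FrustratedLawDichotomySchurCut (effPot w₄₅ ω₄)
open Summit.AtomisticToContinuum.Crystallization.Theorems.FrustratedLawDichotomyMotifLemmas (GoodAtScale)
open Summit.AtomisticToContinuum.Crystallization.Theorems.FrustratedLawDichotomyAveragingRuleTightFree (TightNearCap BadNearCap)
open Summit.AtomisticToContinuum.Crystallization.Theorems.FrustratedLawDichotomyExemptAbsorption (ExemptNear)
open Summit.AtomisticToContinuum.Crystallization.Theorems.FrustratedLawDichotomyStrainedPatchHomSplit
open Summit.AtomisticToContinuum.Crystallization.Theorems.FrustratedLawDichotomyStrainedPatchHomRelief (latPt_fccVec_eq)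
open Summit.AtomisticToContinuum.Crystallization.Theorems.FrustratedLawDichotomyStrainedPatchHomLatticeBox
  (norm_apply_ge_of_near_one latPt_zero mem_box_of_norm_fccPoint_lt)
open Summit.AtomisticToContinuum.Crystallization.Theorems.FrustratedLawDichotomyStrainedPatchHomPrunesFit (goodAtScale_centre_of_fit_fcc)
open Summit.AtomisticToContinuum.Crystallization.Theorems.FrustratedLawDichotomyStrainedPatchHomPruned (pruneFcc_of_centre_good)
open Summit.AtomisticToContinuum.Crystallization.Theorems.FrustratedLawDichotomyStrainedPatchHomPolar (norm_apply_le_of_norm_sub_one_le)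
open Summit.AtomisticToContinuum.Crystallization.Theorems.FrustratedLawDichotomyStrainedPatchHomCertTree
open Summit.AtomisticToContinuum.Crystallization.Theorems.FrustratedLawDichotomyStrainedPatchHomEntryGram
open Summit.AtomisticToContinuum.Crystallization.Theorems.FrustratedLawDichotomyStrainedPatchHomEntryFitKit
open Summit.AtomisticToContinuum.Crystallization.Theorems.FrustratedLawDichotomyStrainedPatchHomEntryFit
open Summit.AtomisticToContinuum.Crystallization.Theorems.FrustratedLawDichotomyStrainedPatchHomEntryFitSharp (goodAtScale_of_fitBounds_min fitOK2 entryLeafOKF2 entryLeafOKF2_sound)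
open Summit.AtomisticToContinuum.Crystallization.Theorems.FrustratedLawDichotomyStrainedPatchHomCoords (apply_eq_sum_entries)
open Literature.Geometry.DiscreteGeometry (intVec intVec_apply)
open Literature.Barriers.AtomisticToContinuum.FlatleyTheil2015 (fccVec fccPoint)
/-! ## §1. Cartesian evaluation of `⟪Vq,q⟫` and `‖Vq‖²` -/
/-- `W_a = Σ_b p_b · v_ab` — the `a`-th Cartesian component of `V (intVec p)`, from the deviation entries. -/
def wRow (E : Fin 3 × Fin 3 → FI) (p : Fin 3 → ℤ) (a : Fin 3) : FI :=
  (((E (a, 0)).mulInt (p 0)).add ((E (a, 1)).mulInt (p 1))).add ((E (a, 2)).mulInt (p 2))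
/-- `½ Σ_a p_a W_a = ⟪V q, q⟫` for `q = (√2)⁻¹ • intVec p`. -/
def pCart (E : Fin 3 × Fin 3 → FI) (p : Fin 3 → ℤ) : FI :=
  ((((wRow E p 0).mulInt (p 0)).add ((wRow E p 1).mulInt (p 1))).add ((wRow E p 2).mulInt (p 2))).divNat 2
/-- `½ Σ_a W_a² = ‖V q‖²` for `q = (√2)⁻¹ • intVec p`. -/
def nCart (E : Fin 3 × Fin 3 → FI) (p : Fin 3 → ℤ) : FI :=
  ((((wRow E p 0).mul (wRow E p 0)).add ((wRow E p 1).mul (wRow E p 1))).add ((wRow E p 2).mul (wRow E p 2))).divNat 2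
/-- `wRow` encloses the Cartesian components of `V (intVec p)`. [formal bookkeeping] -/
theorem mem_wRow (V : E3 →L[ℝ] E3) {E : Fin 3 × Fin 3 → FI} (h : ∀ ab : Fin 3 × Fin 3, FI.mem ((V (EuclideanSpace.single ab.2 (1 : ℝ))) ab.1) (E ab))
    (p : Fin 3 → ℤ) (a : Fin 3) : FI.mem ((V (intVec p)) a) (wRow E p a) := by
  rw [apply_eq_sum_entries]
  simp only [Fin.sum_univ_three, intVec_apply, wRow]
  exact FI.mem_add (FI.mem_add (FI.mem_mulInt (h (a, 0)) _) (FI.mem_mulInt (h (a, 1)) _)) (FI.mem_mulInt (h (a, 2)) _)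
/-- ★ `pCart` encloses `⟪V q, q⟫`, `q = (√2)⁻¹ • intVec p`. [folklore] -/
theorem mem_pCart (V : E3 →L[ℝ] E3) {E : Fin 3 × Fin 3 → FI} (h : ∀ ab : Fin 3 × Fin 3, FI.mem ((V (EuclideanSpace.single ab.2 (1 : ℝ))) ab.1) (E ab))
    (p : Fin 3 → ℤ) : FI.mem ⟪V ((Real.sqrt 2)⁻¹ • intVec p), (Real.sqrt 2)⁻¹ • intVec p⟫ (pCart E p) := by
  have hc : (Real.sqrt 2)⁻¹ * (Real.sqrt 2)⁻¹ = 1 / 2 := by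
    rw [← mul_inv, Real.mul_self_sqrt (by norm_num : (0 : ℝ) ≤ 2)]; norm_num
  have e : ⟪V ((Real.sqrt 2)⁻¹ • intVec p), (Real.sqrt 2)⁻¹ • intVec p⟫ =
      ((V (intVec p)) 0 * ((p 0 : ℤ) : ℝ) + (V (intVec p)) 1 * ((p 1 : ℤ) : ℝ) + (V (intVec p)) 2 * ((p 2 : ℤ) : ℝ)) / (2 : ℕ) := by
    rw [map_smul, real_inner_smul_left, real_inner_smul_right, ← mul_assoc, hc,
      FrustratedLawDichotomyStrainedPatchHomLeafCalculus.inner_eq_sum_apply, Fin.sum_univ_three]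
    simp only [intVec_apply, Nat.cast_ofNat]
    ring
  rw [e]
  exact FI.mem_divNat (FI.mem_add (FI.mem_add (FI.mem_mulInt (mem_wRow V h p 0) _) (FI.mem_mulInt (mem_wRow V h p 1) _))
    (FI.mem_mulInt (mem_wRow V h p 2) _)) (by norm_num)
/-- ★ `nCart` encloses `‖V q‖²`, `q = (√2)⁻¹ • intVec p`. [folklore] -/
theorem mem_nCart (V : E3 →L[ℝ] E3) {E : Fin 3 × Fin 3 → FI} (h : ∀ ab : Fin 3 × Fin 3, FI.mem ((V (EuclideanSpace.single ab.2 (1 : ℝ))) ab.1) (E ab))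
    (p : Fin 3 → ℤ) : FI.mem (‖V ((Real.sqrt 2)⁻¹ • intVec p)‖ ^ 2) (nCart E p) := by
  have e : ‖V ((Real.sqrt 2)⁻¹ • intVec p)‖ ^ 2 =
      ((V (intVec p)) 0 * (V (intVec p)) 0 + (V (intVec p)) 1 * (V (intVec p)) 1 + (V (intVec p)) 2 * (V (intVec p)) 2) / (2 : ℕ) := by
    rw [map_smul, norm_smul, mul_pow, Real.norm_eq_abs, sq_abs, inv_pow, Real.sq_sqrt (by norm_num : (0 : ℝ) ≤ 2),
      EuclideanSpace.norm_sq_eq, Fin.sum_univ_three]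
    simp only [Real.norm_eq_abs, sq_abs, Nat.cast_ofNat]
    ring
  rw [e]
  exact FI.mem_divNat (FI.mem_add (FI.mem_add (FI.mem_mul (mem_wRow V h p 0) (mem_wRow V h p 0)) (FI.mem_mul (mem_wRow V h p 1) (mem_wRow V h p 1)))
    (FI.mem_mul (mem_wRow V h p 2) (mem_wRow V h p 2))) (by norm_num)
/-! ## §2. The Cartesian sharp verdict and its soundness -/
/-- Data of the label `b` in Cartesian form: `⟪Vq,q⟫` for `q = fccPoint b = (√2)⁻¹ • intVec (recon b)`. -/
def pC (c w : Fin 3 × Fin 3 → ℤ) (L : ℤ) (b : Fin 3 → ℤ) : FI := pCart (devFI c w L) (recon b)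
/-- `‖Vq‖²` in Cartesian form. -/
def nC (c w : Fin 3 × Fin 3 → ℤ) (L : ℤ) (b : Fin 3 → ℤ) : FI := nCart (devFI c w L) (recon b)
/-- `‖U q‖² = λ² + 2λ⟪Vq,q⟫ + ‖Vq‖²` in Cartesian form. -/
def kissSqC (c w : Fin 3 × Fin 3 → ℤ) (L : ℤ) (b : Fin 3 → ℤ) : FI :=
  ((FI.ofScaled L).mul (FI.ofScaled L)).add ((((FI.ofScaled L).mul (pC c w L b)).mulInt 2).add (nC c w L b))
/-- Enclosure of `d²` (Cartesian form). -/
def dSqC (c w : Fin 3 × Fin 3 → ℤ) (L : ℤ) : FI := ⟨lmin (K12.map fun b => (kissSqC c w L b).lo), lmin (K12.map fun b => (kissSqC c w L b).hi)⟩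
/-- Enclosure of `d` (Cartesian form). -/
def dEnclC (c w : Fin 3 × Fin 3 → ℤ) (L : ℤ) : FI := FI.sqrt (dSqC c w L)
/-- Smallest lower end of `⟪Vq', q'⟫` over the twelve kissing labels (Cartesian form, scaled). -/
def pMinC (c w : Fin 3 × Fin 3 → ℤ) (L : ℤ) : ℤ := lmin (K12.map fun b => (pC c w L b).lo)
/-- Upper end of the tangential part `‖Vq‖² − ⟪Vq, q⟫²` (Cartesian form), floored at `0` (scaled). -/
def tangHiC (c w : Fin 3 × Fin 3 → ℤ) (L : ℤ) (b : Fin 3 → ℤ) : ℤ := max 0 ((nC c w L b).sub ((pC c w L b).mul (pC c w L b))).hi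
/-- ★ **THE CARTESIAN SHARP (P1) FIT VERDICT on an entry box**: `fitOK2` with all kissing-label data in Cartesian form (`pC`, `nC`, `kissSqC`, `dSqC`, `dEnclC`,
`pMinC`, `tangHiC`); the off-shell far check keeps the frame Gram forms. -/
def fitOK3 (c w : Fin 3 × Fin 3 → ℤ) : Bool :=
  let L := scaleL c
  decide (0 ≤ L) && decide (0 < (dEnclC c w L).lo) && decide ((dEnclC c w L).lo ≤ (dEnclC c w L).hi) && decide (2 * (dEnclC c w L).hi ≤ 3 * (SC : ℤ)) &&
  decide (8 * (130 * (dEnclC c w L).hi + SC) ^ 2 < 270000 * ((SC : ℤ) * SC)) && decide ((SC : ℤ) ≤ 130 * (dEnclC c w L).lo) &&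
  K12.all (fun b =>
    decide ((SC : ℤ) ≤ 2 * (L + (pC c w L b).lo)) &&
    decide (1000000 * ((max 0 ((pC c w L b).hi - pMinC c w L)) ^ 2 + (tangHiC c w L b) ^ 2 + tangHiC c w L b * SC) ≤
      2401 * (dSqC c w L).lo * SC) &&
    decide ((kissSqC c w L b).hi * SC * 10000 ≤ (130 * (dEnclC c w L).lo - SC) ^ 2)) &&
  decide (∀ b ∈ box2, b ≠ 0 → recon b ∉ fccInt → (130 * (dEnclC c w L).hi + (SC : ℤ)) ^ 2 ≤ (qformFI (gramT c w) b).lo * SC * 10000)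
/-- ★★ **SOUNDNESS OF THE CARTESIAN SHARP FIT VERDICT**: `fitOK3 c w = true` ⟹ the prune disjunct `PruneFcc U` for every `U` with `‖U − 1‖ ≤ 1/4` whose entries lie in
the box. [folklore] -/
theorem fitOK3_sound {c w : Fin 3 × Fin 3 → ℤ} (h : fitOK3 c w = true) (U : E3 →L[ℝ] E3) (hU : ‖U - 1‖ ≤ 1 / 4)
    (hbox : ∀ ab : Fin 3 × Fin 3, |(U (EuclideanSpace.single ab.2 (1 : ℝ))) ab.1 - (c ab : ℝ) / SC| ≤ (w ab : ℝ) / SC) :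
    ∀ (M : ℕ) (z : Fin M → E3) (c : Fin M), Function.Injective z →
      Set.range z = {x : E3 | dist x (z c) ≤ 133 / 10 ∧ ∃ a : Fin 3 → ℤ, x = z c + latPt U fccVec a} →
      TightNearCap (9 / 5) (3 / 2) z c ∨ ExemptNear (9 / 5) ExRec z c ∨ BadNearCap (9 / 5) (3 / 2) z c := by
  simp only [fitOK3, Bool.and_eq_true, decide_eq_true_eq, List.all_eq_true] at h
  obtain ⟨⟨⟨⟨⟨⟨⟨hL0, h0⟩, h01⟩, h32⟩, hthr⟩, h130⟩, hK⟩, hfar⟩ := h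
  have hS := SC_pos
  have hne := SC_ne
  -- the deviation `V = U − λ·1` and the real identities
  set lam : ℝ := (scaleL c : ℝ) / SC with hlam
  have hlam0 : 0 ≤ lam := div_nonneg (by exact_mod_cast hL0) hS.le
  set V : E3 →L[ℝ] E3 := U - lam • (1 : E3 →L[ℝ] E3) with hVdef
  have hV : ∀ x : E3, U x = lam • x + V x := fun x => by
    have : V x = U x - lam • x := by simp [hVdef]
    rw [this]; abel
  have hE' := mem_devFI U (scaleL c) hbox
  have hN' : ∀ b, FI.mem (‖V (fccPoint b)‖ ^ 2) (nC c w (scaleL c) b) := fun b => by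
    rw [fccPoint_eq_smul_intVec]; exact mem_nCart V hE' (recon b)
  have hP' : ∀ b, FI.mem ⟪V (fccPoint b), fccPoint b⟫ (pC c w (scaleL c) b) := fun b => by
    rw [fccPoint_eq_smul_intVec]; exact mem_pCart V hE' (recon b)
  have hN : ∀ b, FI.mem (‖latPt U fccVec b‖ ^ 2) (qformFI (gramT c w) b) := fun b => mem_normSq_latPt U hbox b
  have hlamm : FI.mem lam (FI.ofScaled (scaleL c)) := FI.mem_ofScaled (scaleL c)
  -- kissing labels: `‖U q‖² = λ² + 2λ⟪Vq,q⟫ + ‖Vq‖²`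
  have hkiss : ∀ b ∈ K12, FI.mem (‖U (fccPoint b)‖ ^ 2) (kissSqC c w (scaleL c) b) := fun b hb => by
    have hq1 : ‖fccPoint b‖ = 1 := norm_eq_one_of_mem_fccKissingPattern (fccPoint_mem_pattern hb)
    have e : ‖U (fccPoint b)‖ ^ 2 = lam * lam + (lam * ⟪V (fccPoint b), fccPoint b⟫ * ((2 : ℤ) : ℝ) + ‖V (fccPoint b)‖ ^ 2) := by
      rw [hV, norm_add_sq_real, norm_smul, Real.norm_eq_abs, hq1, real_inner_smul_left, real_inner_comm]
      push_cast; rw [mul_one, sq_abs]; ring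
    rw [e]
    exact FI.mem_add (FI.mem_mul hlamm hlamm) (FI.mem_add (FI.mem_mulInt (FI.mem_mul hlamm (hP' b)) 2) (hN' b))
  -- the minimum `d` of the twelve lengths and its enclosures
  have hneP : fccKissingPattern.Nonempty := by rw [← Finset.card_pos, card_fccKissingPattern]; norm_num
  obtain ⟨q₀, hq₀, hdq₀⟩ := Finset.exists_mem_eq_inf' hneP (fun q : E3 => ‖U q‖)
  have hd_le : ∀ q ∈ fccKissingPattern, ‖U q₀‖ ≤ ‖U q‖ := fun q hq => by rw [← hdq₀]; exact Finset.inf'_le _ hq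
  have hd0 : 0 ≤ ‖U q₀‖ := norm_nonneg _
  have hDsq_lo : ∀ q ∈ fccKissingPattern, ((dSqC c w (scaleL c)).lo : ℝ) ≤ ‖U q‖ ^ 2 * SC := fun q hq => by
    obtain ⟨b, hb, rfl⟩ := exists_label_of_mem_pattern hq
    have h1 : lmin (K12.map fun b => (kissSqC c w (scaleL c) b).lo) ≤ (kissSqC c w (scaleL c) b).lo :=
      lmin_le_of_mem _ _ (List.mem_map.2 ⟨b, hb, rfl⟩)
    have h1' : ((lmin (K12.map fun b => (kissSqC c w (scaleL c) b).lo) : ℤ) : ℝ) ≤ (kissSqC c w (scaleL c) b).lo := by exact_mod_cast h1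
    exact h1'.trans (FI.mem_def.1 (hkiss b hb)).1
  have hmemDsq : FI.mem (‖U q₀‖ ^ 2) (dSqC c w (scaleL c)) := by
    refine ⟨hDsq_lo q₀ hq₀, ?_⟩
    have hl : (K12.map fun b => (kissSqC c w (scaleL c) b).hi) ≠ [] := by simp [K12]
    obtain ⟨b', hb', he⟩ := List.mem_map.1 (lmin_mem _ hl)
    have hpat := fccPoint_mem_pattern hb'
    have h2 := (FI.mem_def.1 (hkiss b' hb')).2
    have hle : ‖U q₀‖ ^ 2 ≤ ‖U (fccPoint b')‖ ^ 2 := pow_le_pow_left₀ hd0 (hd_le _ hpat) 2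
    have hle' := mul_le_mul_of_nonneg_right hle hS.le
    show ‖U q₀‖ ^ 2 * SC ≤ (((dSqC c w (scaleL c)).hi : ℤ) : ℝ)
    rw [show (dSqC c w (scaleL c)).hi = lmin (K12.map fun b => (kissSqC c w (scaleL c) b).hi) from rfl, ← he]
    linarith
  have hmemD : FI.mem ‖U q₀‖ (dEnclC c w (scaleL c)) := by
    have := FI.mem_sqrt hmemDsq
    rwa [Real.sqrt_sq hd0] at this
  obtain ⟨hDlo, hDhi⟩ := FI.mem_def.1 hmemD
  have h0' : (0 : ℝ) < (dEnclC c w (scaleL c)).lo := by exact_mod_cast h0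
  have hDhi0 : (0 : ℝ) ≤ (dEnclC c w (scaleL c)).hi := by exact_mod_cast (h0.le.trans h01)
  refine pruneFcc_of_centre_good (goodAtScale_of_fitBounds_min U hU (dlo := ((dEnclC c w (scaleL c)).lo : ℝ) / SC)
    (dhi := ((dEnclC c w (scaleL c)).hi : ℝ) / SC) (d2lo := ((dSqC c w (scaleL c)).lo : ℝ) / SC) (div_pos h0' hS) ?_ ?_ ?_ ?_ ?_ ?_ ?_ ?_)
  · -- dhi ≤ 3/2
    rw [div_le_iff₀ hS]
    have : (2 : ℝ) * (dEnclC c w (scaleL c)).hi ≤ 3 * SC := by exact_mod_cast h32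
    linarith
  · -- 8 thr² < 27
    have hthr' : (8 : ℝ) * (130 * (dEnclC c w (scaleL c)).hi + SC) ^ 2 < 270000 * (SC * SC) := by exact_mod_cast hthr
    have e : (13 : ℝ) / 10 * ((dEnclC c w (scaleL c)).hi / SC) + 1 / 100 = (130 * (dEnclC c w (scaleL c)).hi + SC) / (100 * SC) := by
      field_simp; ring
    rw [e, div_pow, show (8 : ℝ) * ((130 * ((dEnclC c w (scaleL c)).hi : ℝ) + SC) ^ 2 / (100 * SC) ^ 2) =
      (8 * (130 * ((dEnclC c w (scaleL c)).hi : ℝ) + SC) ^ 2) / (100 * SC) ^ 2 by ring, div_lt_iff₀ (by positivity)]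
    linarith
  · -- (d) lower
    intro q hq
    have := mul_le_mul_of_nonneg_right (hd_le q hq) hS.le
    rw [div_le_iff₀ hS]
    linarith
  · -- (d) upper
    exact ⟨q₀, hq₀, by rw [le_div_iff₀ hS]; exact hDhi⟩
  · -- d2lo ≤ ‖U q‖²
    intro q hq
    rw [div_le_iff₀ hS]
    exact hDsq_lo q hq
  · -- (F1) the sharp fit at the minimising scale: `‖Uq − d q‖² = (⟪Uq,q⟫ − d)² + (‖Uq‖² − ⟪Uq,q⟫²)`
    intro q hq q' hq' hmin
    obtain ⟨b, hb, rfl⟩ := exists_label_of_mem_pattern hq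
    obtain ⟨b', hb', rfl⟩ := exists_label_of_mem_pattern hq'
    obtain ⟨⟨f0, f1⟩, _⟩ := hK b hb
    have hq1 : ‖fccPoint b‖ = 1 := norm_eq_one_of_mem_fccKissingPattern hq
    have hq1' : ‖fccPoint b'‖ = 1 := norm_eq_one_of_mem_fccKissingPattern hq'
    -- the data: `P = ⟪Vq,q⟫`, `N = ‖Vq‖²`, `⟪Uq,q⟫ = λ + P`, `‖Uq‖² = λ² + 2λP + N`
    set P := ⟪V (fccPoint b), fccPoint b⟫ with hPdef
    set N := ‖V (fccPoint b)‖ ^ 2 with hNdef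
    set d := ‖U (fccPoint b')‖ with hddef
    have hPm := hP' b
    have hNm := hN' b
    have hinner : ⟪U (fccPoint b), fccPoint b⟫ = lam + P := by
      rw [hV, inner_add_left, real_inner_smul_left, real_inner_self_eq_norm_sq, hq1]; ring
    have hnormsq : ‖U (fccPoint b)‖ ^ 2 = lam * lam + 2 * lam * P + N := by
      rw [hV, norm_add_sq_real, norm_smul, Real.norm_eq_abs, hq1, real_inner_smul_left, real_inner_comm, abs_of_nonneg hlam0]; ring
    -- Pythagoras for the misfit
    have hpy : ‖U (fccPoint b) - d • fccPoint b‖ ^ 2 = (lam + P - d) ^ 2 + (N - P ^ 2) := by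
      rw [norm_sub_sq_real, inner_smul_right, hinner, norm_smul, Real.norm_eq_abs, hq1, mul_one, sq_abs, hnormsq]; ring
    -- tangential part: `0 ≤ N − P²` (Cauchy–Schwarz) and `N − P² ≤ T2/SC`
    have hcs : P ≤ ‖V (fccPoint b)‖ := by
      have := real_inner_le_norm (V (fccPoint b)) (fccPoint b); rw [hq1, mul_one] at this; exact this
    have hcs' : -‖V (fccPoint b)‖ ≤ P := by
      have := real_inner_le_norm (V (fccPoint b)) (-(fccPoint b))
      rw [inner_neg_right, norm_neg, hq1, mul_one] at this; linarith
    have ht0 : 0 ≤ N - P ^ 2 := by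
      have : P ^ 2 ≤ ‖V (fccPoint b)‖ ^ 2 := sq_le_sq' hcs' hcs
      linarith
    have hT : FI.mem (N - P * P) ((nC c w (scaleL c) b).sub ((pC c w (scaleL c) b).mul (pC c w (scaleL c) b))) :=
      FI.mem_sub hNm (FI.mem_mul hPm hPm)
    have hThi : (N - P ^ 2) * SC ≤ (tangHiC c w (scaleL c) b : ℝ) := by
      have h1 := (FI.mem_def.1 hT).2
      have h2 : (((nC c w (scaleL c) b).sub ((pC c w (scaleL c) b).mul (pC c w (scaleL c) b))).hi : ℝ) ≤
          (tangHiC c w (scaleL c) b : ℝ) := by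
        have := le_max_right 0 ((nC c w (scaleL c) b).sub ((pC c w (scaleL c) b).mul (pC c w (scaleL c) b))).hi
        unfold tangHiC; exact_mod_cast this
      rw [show N - P ^ 2 = N - P * P by ring]; exact h1.trans h2
    have hTnn : (0 : ℝ) ≤ tangHiC c w (scaleL c) b := by exact_mod_cast le_max_left 0 _
    -- radial part, upper: `λ + P − d ≤ P − ⟪Vq',q'⟫ ≤ (P.hi − Pmin)/SC`
    have hinner' : ⟪U (fccPoint b'), fccPoint b'⟫ = lam + ⟪V (fccPoint b'), fccPoint b'⟫ := by
      rw [hV, inner_add_left, real_inner_smul_left, real_inner_self_eq_norm_sq, hq1']; ring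
    have hdlow : lam + ⟪V (fccPoint b'), fccPoint b'⟫ ≤ d := by
      rw [← hinner']
      have := real_inner_le_norm (U (fccPoint b')) (fccPoint b'); rw [hq1', mul_one] at this; exact this
    have hPmin : (pMinC c w (scaleL c) : ℝ) ≤ ⟪V (fccPoint b'), fccPoint b'⟫ * SC := by
      have h1 : lmin (K12.map fun b => (pC c w (scaleL c) b).lo) ≤ (pC c w (scaleL c) b').lo :=
        lmin_le_of_mem _ _ (List.mem_map.2 ⟨b', hb', rfl⟩)
      have h1' : (pMinC c w (scaleL c) : ℝ) ≤ (pC c w (scaleL c) b').lo := by unfold pMinC; exact_mod_cast h1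
      exact h1'.trans (FI.mem_def.1 (hP' b')).1
    have hPhi := (FI.mem_def.1 hPm).2
    have hR1 : (lam + P - d) * SC ≤ (max 0 ((pC c w (scaleL c) b).hi - pMinC c w (scaleL c)) : ℤ) := by
      have : (lam + P - d) * SC ≤ ((pC c w (scaleL c) b).hi : ℝ) - pMinC c w (scaleL c) := by
        have h3 := mul_le_mul_of_nonneg_right hdlow hS.le
        have e3 : (lam + ⟪V (fccPoint b'), fccPoint b'⟫) * SC = lam * SC + ⟪V (fccPoint b'), fccPoint b'⟫ * SC := by ring
        have e4 : (lam + P - d) * SC = lam * SC + P * SC - d * SC := by ring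
        rw [e3] at h3; rw [e4]; linarith
      have h2 : (((pC c w (scaleL c) b).hi - pMinC c w (scaleL c) : ℤ) : ℝ) ≤
          (max 0 ((pC c w (scaleL c) b).hi - pMinC c w (scaleL c)) : ℤ) := by exact_mod_cast le_max_right _ _
      push_cast at h2 ⊢; linarith
    -- radial part, lower: `λ + P − d ≥ ⟪Uq,q⟫ − ‖Uq‖ ≥ −(N − P²)` (using `d ≤ ‖Uq‖` and `2⟪Uq,q⟫ ≥ 1`)
    have hdq : d ≤ ‖U (fccPoint b)‖ := hmin _ hq
    have hpos : (1 : ℝ) ≤ 2 * (lam + P) := by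
      have f0' : (SC : ℝ) ≤ 2 * (scaleL c + (pC c w (scaleL c) b).lo) := by exact_mod_cast f0
      have hPlo := (FI.mem_def.1 hPm).1
      have e : lam * SC = scaleL c := by rw [hlam]; exact div_mul_cancel₀ _ hne
      have : 1 * (SC : ℝ) ≤ 2 * (lam + P) * SC := by
        rw [show 2 * (lam + P) * (SC : ℝ) = 2 * (lam * SC) + 2 * (P * SC) by ring, e]; linarith
      exact le_of_mul_le_mul_right this hS
    have hlowr : -(N - P ^ 2) ≤ lam + P - d := by
      -- `‖Uq‖ − ⟪Uq,q⟫ = (N − P²)/(‖Uq‖ + ⟪Uq,q⟫) ≤ N − P²` since the denominator is `≥ 2⟪Uq,q⟫ ≥ 1`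
      have hUq : ⟪U (fccPoint b), fccPoint b⟫ ≤ ‖U (fccPoint b)‖ := by
        have := real_inner_le_norm (U (fccPoint b)) (fccPoint b); rw [hq1, mul_one] at this; exact this
      rw [hinner] at hUq
      have hden : 1 ≤ ‖U (fccPoint b)‖ + (lam + P) := by linarith
      have hprod : (‖U (fccPoint b)‖ - (lam + P)) * (‖U (fccPoint b)‖ + (lam + P)) = N - P ^ 2 := by
        rw [show (‖U (fccPoint b)‖ - (lam + P)) * (‖U (fccPoint b)‖ + (lam + P)) = ‖U (fccPoint b)‖ ^ 2 - (lam + P) ^ 2 by ring, hnormsq]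
        ring
      have hdiff : ‖U (fccPoint b)‖ - (lam + P) ≤ N - P ^ 2 := by
        have h1 : 0 ≤ ‖U (fccPoint b)‖ - (lam + P) := by linarith
        have h2 := mul_le_mul_of_nonneg_left hden h1
        rw [mul_one, hprod] at h2
        exact h2
      linarith
    -- assemble: misfit² ≤ (R1² + T2²)/SC² + T2/SC ≤ η'² · Dsq.lo/SC
    have f1' : (1000000 : ℝ) * (((max 0 ((pC c w (scaleL c) b).hi - pMinC c w (scaleL c)) : ℤ) : ℝ) ^ 2 +
        (tangHiC c w (scaleL c) b : ℝ) ^ 2 + (tangHiC c w (scaleL c) b : ℝ) * SC) ≤ 2401 * (dSqC c w (scaleL c)).lo * SC := by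
      exact_mod_cast f1
    have hR0 : (0 : ℝ) ≤ ((max 0 ((pC c w (scaleL c) b).hi - pMinC c w (scaleL c)) : ℤ) : ℝ) := by
      exact_mod_cast le_max_left _ _
    have hrsq : ((lam + P - d) * SC) ^ 2 ≤ (((max 0 ((pC c w (scaleL c) b).hi - pMinC c w (scaleL c)) : ℤ) : ℝ)) ^ 2 +
        (tangHiC c w (scaleL c) b : ℝ) ^ 2 := by
      rcases le_total 0 (lam + P - d) with hr | hr
      · have := pow_le_pow_left₀ (mul_nonneg hr hS.le) hR1 2
        linarith [sq_nonneg (tangHiC c w (scaleL c) b : ℝ)]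
      · have h1 : (-(lam + P - d)) * SC ≤ (tangHiC c w (scaleL c) b : ℝ) := by
          have h4 : -(lam + P - d) ≤ N - P ^ 2 := by linarith
          have h5 := mul_le_mul_of_nonneg_right h4 hS.le
          linarith
        have := pow_le_pow_left₀ (mul_nonneg (neg_nonneg.2 hr) hS.le) h1 2
        have e : (-(lam + P - d) * SC) ^ 2 = ((lam + P - d) * SC) ^ 2 := by ring
        rw [e] at this
        linarith [sq_nonneg (((max 0 ((pC c w (scaleL c) b).hi - pMinC c w (scaleL c)) : ℤ) : ℝ))]
    rw [hpy, show (49 / 1000 : ℝ) ^ 2 * (((dSqC c w (scaleL c)).lo : ℝ) / SC) = 2401 * ((dSqC c w (scaleL c)).lo : ℝ) / (1000000 * SC) by ring,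
      le_div_iff₀ (by positivity)]
    have e1 : ((lam + P - d) ^ 2 + (N - P ^ 2)) * (1000000 * SC) * SC =
        1000000 * (((lam + P - d) * SC) ^ 2 + ((N - P ^ 2) * SC) * SC) := by ring
    have key : ((lam + P - d) ^ 2 + (N - P ^ 2)) * (1000000 * SC) * SC ≤ 2401 * ((dSqC c w (scaleL c)).lo : ℝ) * SC := by
      rw [e1]
      have h3 := mul_le_mul_of_nonneg_right hThi hS.le
      linarith [hrsq, h3, f1']
    exact le_of_mul_le_mul_right key hS
  · -- (F2) clean gap
    intro q hq
    obtain ⟨b, hb, rfl⟩ := exists_label_of_mem_pattern hq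
    obtain ⟨_, f3⟩ := hK b hb
    have hC := (FI.mem_def.1 (hkiss b hb)).2
    have f3' : ((kissSqC c w (scaleL c) b).hi : ℝ) * SC * 10000 ≤ (130 * (dEnclC c w (scaleL c)).lo - SC) ^ 2 := by exact_mod_cast f3
    have h130' : (SC : ℝ) ≤ 130 * (dEnclC c w (scaleL c)).lo := by exact_mod_cast h130
    have hC' := mul_le_mul_of_nonneg_right hC (by positivity : (0 : ℝ) ≤ SC * 10000)
    have hsq : (‖U (fccPoint b)‖ * (100 * SC)) ^ 2 ≤ ((130 : ℝ) * (dEnclC c w (scaleL c)).lo - SC) ^ 2 := by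
      have e : (‖U (fccPoint b)‖ * (100 * SC)) ^ 2 = ‖U (fccPoint b)‖ ^ 2 * SC * (SC * 10000) := by ring
      rw [e]; linarith
    have hle := (abs_le_of_sq_le_sq' hsq (by linarith)).2
    rw [show (13 : ℝ) / 10 * (((dEnclC c w (scaleL c)).lo : ℝ) / SC) - 1 / 100 = (130 * ((dEnclC c w (scaleL c)).lo : ℝ) - SC) / (100 * SC) by
      field_simp; ring, le_div_iff₀ (by positivity)]
    exact hle
  · -- (F3) far
    intro b hb hb0 hrec
    rw [← box2_eq] at hb
    have f4 : ((130 : ℝ) * (dEnclC c w (scaleL c)).hi + SC) ^ 2 ≤ ((qformFI (gramT c w) b).lo : ℝ) * SC * 10000 := by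
      exact_mod_cast hfar b hb hb0 hrec
    have hC := (FI.mem_def.1 (hN b)).1
    have hC' := mul_le_mul_of_nonneg_right hC (by positivity : (0 : ℝ) ≤ SC * 10000)
    have hsq : ((130 : ℝ) * (dEnclC c w (scaleL c)).hi + SC) ^ 2 ≤ (‖latPt U fccVec b‖ * (100 * SC)) ^ 2 := by
      have e : (‖latPt U fccVec b‖ * (100 * SC)) ^ 2 = ‖latPt U fccVec b‖ ^ 2 * SC * (SC * 10000) := by ring
      rw [e]; linarith
    have hle := (abs_le_of_sq_le_sq' hsq (by positivity)).2
    rw [show (13 : ℝ) / 10 * (((dEnclC c w (scaleL c)).hi : ℝ) / SC) + 1 / 100 = (130 * ((dEnclC c w (scaleL c)).hi : ℝ) + SC) / (100 * SC) by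
      field_simp; ring, div_le_iff₀ (by positivity)]
    exact hle
/-! ## §3. The combined verdict and the fcc half -/
/-- ★ **ENTRY-LEAF VERDICT with the Cartesian sharp fit**: `fitOK3 ∨ entryLeafOKF2` (= `fitOK3 ∨ fitOK2 ∨ fitOK ∨ symmetry ∨ column ∨ (P4)`). -/
def entryLeafOKF3 (μ : ℤ) (c w : Fin 3 × Fin 3 → ℤ) : Bool := fitOK3 c w || entryLeafOKF2 μ c w

/-- ★ Soundness of `entryLeafOKF3` (shape of `…HomEntryGram.fccHalf_of_entryTree`). [folklore] -/
theorem entryLeafOKF3_sound {μ : ℤ} {c w : Fin 3 × Fin 3 → ℤ} (h : entryLeafOKF3 μ c w = true) (U : E3 →L[ℝ] E3)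
    (hsa : ∀ v v' : E3, ⟪U v, v'⟫ = ⟪v, U v'⟫) (hU : ‖U - 1‖ ≤ 1 / 4)
    (hbox : ∀ ab : Fin 3 × Fin 3, |(U (EuclideanSpace.single ab.2 (1 : ℝ))) ab.1 - (c ab : ℝ) / SC| ≤ (w ab : ℝ) / SC) :
    (∀ (M : ℕ) (z : Fin M → E3) (c : Fin M), Function.Injective z →
        Set.range z = {x : E3 | dist x (z c) ≤ 133 / 10 ∧ ∃ a : Fin 3 → ℤ, x = z c + latPt U fccVec a} →
        TightNearCap (9 / 5) (3 / 2) z c ∨ ExemptNear (9 / 5) ExRec z c ∨ BadNearCap (9 / 5) (3 / 2) z c) ∨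
      (μ : ℝ) / SC ≤ ∑ b ∈ (Fintype.piFinset fun _ : Fin 3 => Finset.Icc (-7 : ℤ) 7).filter (fun b => b ≠ 0),
        effPot w₄₅ ω₄ (3 / 400) ‖latPt U fccVec b‖ := by
  simp only [entryLeafOKF3, Bool.or_eq_true] at h
  rcases h with h | h
  · exact Or.inl (fitOK3_sound h U hU hbox)
  · exact entryLeafOKF2_sound h U hsa hU hbox

/-- ★★★ **THE fcc HALF OF `(H)` FROM ONE BOOLEAN with the Cartesian sharp fit prune.** [folklore] -/
theorem fccHalf_of_entryFit3Tree {m : ℝ} {μ : ℤ} (hμ : 2 * (m + (-(7175 / 10000) + 3 / 400)) * SC ≤ μ)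
    {t : CertTree (Fin 3 × Fin 3)} (h : treeOK (entryLeafOKF3 μ) t rootC rootW = true) :
    ∀ U : E3 →L[ℝ] E3, (∀ v w : E3, inner ℝ (U v) w = inner ℝ v (U w)) → (∀ w : E3, 0 ≤ inner ℝ w (U w)) → ‖U - 1‖ ≤ 1 / 4 →
      (∀ (M : ℕ) (z : Fin M → E3) (c : Fin M), Function.Injective z →
          Set.range z = {x : E3 | dist x (z c) ≤ 133 / 10 ∧ ∃ a : Fin 3 → ℤ, x = z c + latPt U fccVec a} →
          TightNearCap (9 / 5) (3 / 2) z c ∨ ExemptNear (9 / 5) ExRec z c ∨ BadNearCap (9 / 5) (3 / 2) z c) ∨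
      m ≤ (∑ b ∈ (Fintype.piFinset fun _ : Fin 3 => Finset.Icc (-7 : ℤ) 7).filter (fun b => b ≠ 0),
        effPot w₄₅ ω₄ (3 / 400) ‖latPt U fccVec b‖) / 2 - (-(7175 / 10000) + 3 / 400) :=
  fccHalf_of_entryTree hμ (entryLeafOKF3 μ) (fun _ _ hv U hsa hU hbox => entryLeafOKF3_sound hv U hsa hU hbox) h
/-! ## §4. Kernel smoke test: the Cartesian sharp fit reaches the (P4) region -/
/-- `fitOK3` fires at `0.97·diag(1.05,1,1)` and `0.97·diag(1.06,1,1)` (half-width `2⁻¹⁰`; `fitOK2` fails at `1.05`) and at `0.97·diag(1.03,1,1)` with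
half-width `2⁻⁸`. -/
example : fitOK3 (fun ab => if ab.1 = ab.2 then (if ab.1 = 0 then 286682263779803 else 273030727409336) else 0) (fun _ => 274877906944) = true ∧
    fitOK2 (fun ab => if ab.1 = ab.2 then (if ab.1 = 0 then 286682263779803 else 273030727409336) else 0) (fun _ => 274877906944) = false ∧
    fitOK3 (fun ab => if ab.1 = ab.2 then (if ab.1 = 0 then 289412571053896 else 273030727409336) else 0) (fun _ => 274877906944) = true ∧
    fitOK3 (fun ab => if ab.1 = ab.2 then (if ab.1 = 0 then 281221649231616 else 273030727409336) else 0) (fun _ => 1099511627776) = true := by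
  decide +kernel
end Summit.AtomisticToContinuum.Crystallization.Theorems.FrustratedLawDichotomyStrainedPatchHomEntryFitCart
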